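import Literature.Probability.RandomGraphs.PlantedClique
import Literature.Probability.Moments.HoeffdingCounting
import Literature.Probability.Moments.DisjointCoordinates
import Mathlib.Analysis.SpecialFunctions.Pow.Real
import HarnessLib

/-!
# Planted clique: the probabilistic events of the AKS analysis, counting form (I)

For a FIXED planted set `S ⊆ Fin n` and the uniformly random remainder `x : EdgeVec n` (so that the
graph is `graphOfEdgeVec (plant S x)`, the law `G(n, 1/2, k)` conditioned on the planted set),
this file bounds, by counting over all `x`, two of the three bad events of the analysis of
Alon–Krivelevich–Sudakov 1998, §2.2–2.3, for a seed `S' ⊆ S` and the rest `T = S ∖ S'`,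
`|T| = κ`:

* `card_badDeg_le` — **degrees into the clique** (AKS §2.2, last paragraph: "all vertices outside
  the clique are adjacent, almost surely, to at most `(1+o(1))k/2` vertices of the clique"): the
  `x` for which some vertex `u ∉ S` has `≥ 7κ/12` neighbours in `T` number at most
  `n · e^{-κ/72} · 2^{#E}` (Hoeffding, `Literature.Probability.Moments.hoeffding_count_pi`, per
  vertex, and a union bound);
* `card_badSize_le` — **size of the common neighbourhood** (AKS §2.3: "`|N*(S)| = (1+o(1)) n/2ˢ`
  almost surely"): the `x` for which at least `2n/2ˢ` vertices outside `S` are adjacent to all of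
  `S'` (`|S'| = s`) number at most `(2ˢ/n) · 2^{#E}` (Chebyshev: the indicators of distinct
  vertices depend on disjoint sets of edges, `Literature.Probability.Moments.sum_mul_sum_eq_of_disjoint`,
  and each is a cylinder of `s` edges, `card_filter_forall_eq_true_mul_eq`).

The third event (the norm of the random part of the sign matrix of the common neighbourhood) is
in `PlantedCliqueEventsNorm.lean`.

## References

* N. Alon, M. Krivelevich, B. Sudakov, *Finding a large hidden clique in a random graph*, Random
  Structures Algorithms 13 (1998) 457–466, §2.2–2.3 [AlonKrivelevichSudakov1998].
-/

noncomputable section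

open Finset Real

namespace Literature.Probability.RandomGraphs.PlantedClique

open Literature.Probability.Moments

variable {n : ℕ}

/-! ### The planted graph off the planted set -/

/-- Off the planted set the planted graph is the random graph: for `u ∉ S`, `u ~ v` in
`plant S x` iff the bit of `{u, v}` in `x` is on. [folklore] -/
theorem adj_plant_iff_of_not_mem {S : Finset (Fin n)} (x : EdgeVec n) {u v : Fin n} (hu : u ∉ S)
    (huv : u ≠ v) :
    (graphOfEdgeVec (plant S x)).Adj u v ↔ x ⟨s(u, v), by simpa using huv⟩ = true := by
  classical
  rw [graphOfEdgeVec_adj]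
  constructor
  · rintro ⟨h, hx⟩
    simp only [plant, Bool.or_eq_true, decide_eq_true_eq] at hx
    rcases hx with hx | hx
    · exact hx
    · exact absurd (hx u (Sym2.mem_mk_left u v)) hu
  · intro hx
    refine ⟨huv, ?_⟩
    simp only [plant, Bool.or_eq_true]
    exact Or.inl hx

/-- The edge `{u, w}` for `u ∉ S`, `w ∈ S` (so `u ≠ w`), as an element of the edge set. [folklore] -/
def crossEdge (S : Finset (Fin n)) (u : Fin n) (hu : u ∉ S) (w : {w // w ∈ S}) :
    (⊤ : SimpleGraph (Fin n)).edgeSet :=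
  ⟨s(u, w), by
    have : u ≠ w := fun h => hu (h ▸ w.2)
    simpa using this⟩

/-- `crossEdge S u hu` is injective. [folklore] -/
theorem crossEdge_injective (S : Finset (Fin n)) (u : Fin n) (hu : u ∉ S) :
    Function.Injective (crossEdge S u hu) := by
  intro w w' h
  have h' : (s(u, (w : Fin n)) : Sym2 (Fin n)) = s(u, (w' : Fin n)) := congrArg Subtype.val h
  rw [Sym2.eq_iff] at h'
  rcases h' with ⟨-, h⟩ | ⟨h1, -⟩
  · exact Subtype.ext h
  · exact absurd (h1 ▸ w'.2) hu

/-! ### Degrees into the clique -/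

/-- The bad degree event at a vertex `u`: at least `7κ/12` neighbours in `T`, `κ = |T|`.
[cite: AlonKrivelevichSudakov1998, §2.2 (last paragraph)] -/
def badDegAt (S T : Finset (Fin n)) (u : Fin n) : Finset (EdgeVec n) :=
  open scoped Classical in
  univ.filter fun x => (7 * T.card : ℝ) / 12 ≤
    (T.filter fun w => (graphOfEdgeVec (plant S x)).Adj u w).card

/-- The bad degree event: some vertex outside `S` has at least `7κ/12` neighbours in `T`.
[cite: AlonKrivelevichSudakov1998, §2.2 (last paragraph)] -/
def badDeg (S T : Finset (Fin n)) : Finset (EdgeVec n) :=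
  (univ \ S).biUnion fun u => badDegAt S T u

/-- Membership in the bad degree event at `u`. [folklore] -/
theorem mem_badDegAt {S T : Finset (Fin n)} {u : Fin n} {x : EdgeVec n} :
    x ∈ badDegAt S T u ↔ (7 * T.card : ℝ) / 12 ≤
      (open scoped Classical in (T.filter fun w => (graphOfEdgeVec (plant S x)).Adj u w).card) := by
  simp [badDegAt]

/-- **Hoeffding at one vertex**: for `u ∉ S` and `T ⊆ S` nonempty, the bad degree event at `u`
has at most `e^{-|T|/72} · 2^{#E}` points. [cite: AlonKrivelevichSudakov1998, §2.2 (last paragraph: "the standard estimates for Binomial distributions")] -/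
theorem card_badDegAt_le {S T : Finset (Fin n)} (hTS : T ⊆ S) (hT : 1 ≤ T.card) {u : Fin n}
    (hu : u ∉ S) :
    ((badDegAt S T u).card : ℝ) ≤
      Real.exp (-(T.card / 72 : ℝ)) * 2 ^ Fintype.card (⊤ : SimpleGraph (Fin n)).edgeSet := by
  classical
  set κ : ℕ := T.card with hκ
  -- the relevant edges: `{u, w}`, `w ∈ T`
  set D : Finset (⊤ : SimpleGraph (Fin n)).edgeSet :=
    T.attach.image fun w : {w // w ∈ T} => crossEdge S u hu ⟨w.val, hTS w.property⟩ with hD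
  have hinjD : Set.InjOn (fun w : {w // w ∈ T} => crossEdge S u hu ⟨w.val, hTS w.property⟩)
      ↑T.attach := by
    intro w _ w' _ h
    have := crossEdge_injective S u hu h
    exact Subtype.ext (Subtype.mk.inj this)
  have hDcard : D.card = κ := by rw [hD, card_image_of_injOn hinjD, card_attach]
  -- the Hoeffding data: `f e b = ±1/2` on `D`, `0` elsewhere
  set f : ∀ _ : (⊤ : SimpleGraph (Fin n)).edgeSet, Bool → ℝ :=
    fun e b => if e ∈ D then (if b then 1 / 2 else -(1 / 2)) else 0 with hf
  set c : (⊤ : SimpleGraph (Fin n)).edgeSet → ℝ := fun e => if e ∈ D then 1 / 2 else 0 with hc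
  have hf0 : ∀ e, ∑ b, f e b = 0 := fun e => by
    by_cases he : e ∈ D <;> simp [hf, he]
  have hfc : ∀ e b, |f e b| ≤ c e := fun e b => by
    by_cases he : e ∈ D <;> cases b <;> simp [hf, hc, he]
  have hcsum : ∑ e, c e ^ 2 = κ / 4 := by
    have : ∀ e, c e ^ 2 = if e ∈ D then (1 / 4 : ℝ) else 0 := fun e => by
      by_cases he : e ∈ D <;> norm_num [hc, he]
    simp_rw [this]
    rw [sum_ite_mem, univ_inter, sum_const, hDcard, nsmul_eq_mul]
    ring
  have hκ0 : (0 : ℝ) < κ := by exact_mod_cast hT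
  -- the statistic: `Σ_e f e (x e) = #(neighbours of u in T) - κ/2`
  have hstat : ∀ x : EdgeVec n, ∑ e, f e (x e) =
      ((T.filter fun w => (graphOfEdgeVec (plant S x)).Adj u w).card : ℝ) - κ / 2 := by
    intro x
    have h1 : ∑ e, f e (x e) = ∑ e ∈ D, (if x e then (1 / 2 : ℝ) else -(1 / 2)) := by
      rw [← sum_filter_add_sum_filter_not univ (fun e => e ∈ D)]
      have hA : ∑ e ∈ univ.filter (fun e => e ∈ D), f e (x e) =
          ∑ e ∈ D, (if x e then (1 / 2 : ℝ) else -(1 / 2)) := by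
        have : univ.filter (fun e => e ∈ D) = D := by ext e; simp
        rw [this]
        exact sum_congr rfl fun e he => by simp [hf, he]
      have hB : ∑ e ∈ univ.filter (fun e => ¬ e ∈ D), f e (x e) = 0 :=
        sum_eq_zero fun e he => by simp [hf, (mem_filter.1 he).2]
      rw [hA, hB, add_zero]
    have h2 : ∑ e ∈ D, (if x e then (1 / 2 : ℝ) else -(1 / 2)) =
        ∑ w ∈ T.attach, (if x (crossEdge S u hu ⟨w.val, hTS w.property⟩) then (1 / 2 : ℝ) else -(1 / 2)) := by
      rw [hD, sum_image hinjD]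
    have h3 : ∀ w : {w // w ∈ T}, (x (crossEdge S u hu ⟨w.val, hTS w.property⟩) = true) ↔
        (graphOfEdgeVec (plant S x)).Adj u w := by
      intro w
      have huw : u ≠ w := fun h => hu (h ▸ hTS w.2)
      rw [adj_plant_iff_of_not_mem x hu huw]
      rfl
    have h4 : ∑ w ∈ T.attach, (if x (crossEdge S u hu ⟨w.val, hTS w.property⟩) then (1 / 2 : ℝ) else -(1 / 2))
        = ∑ w ∈ T.attach, ((if (graphOfEdgeVec (plant S x)).Adj u w then (1 : ℝ) else 0) - 1 / 2) := by
      refine sum_congr rfl fun w _ => ?_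
      by_cases h : (graphOfEdgeVec (plant S x)).Adj u w
      · rw [if_pos ((h3 w).2 h), if_pos h]; norm_num
      · have : ¬ x (crossEdge S u hu ⟨w.val, hTS w.property⟩) = true := fun h' => h ((h3 w).1 h')
        rw [if_neg this, if_neg h]; norm_num
    rw [h1, h2, h4, sum_sub_distrib, sum_const, card_attach, nsmul_eq_mul]
    have h5 : ∑ w ∈ T.attach, (if (graphOfEdgeVec (plant S x)).Adj u w then (1 : ℝ) else 0) =
        ((T.filter fun w => (graphOfEdgeVec (plant S x)).Adj u w).card : ℝ) := by
      rw [Finset.sum_attach T fun w => if (graphOfEdgeVec (plant S x)).Adj u w then (1 : ℝ) else 0,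
        sum_boole]
    rw [h5]
    ring
  -- Hoeffding
  have ht : (0 : ℝ) ≤ κ / 12 := by positivity
  have hSpos : 0 < ∑ e, c e ^ 2 := by rw [hcsum]; positivity
  have hH := hoeffding_count_pi (κ := fun _ => Bool) f c hf0 hfc ht hSpos
  have hprod : ∏ _e : (⊤ : SimpleGraph (Fin n)).edgeSet, (Fintype.card Bool : ℝ) =
      2 ^ Fintype.card (⊤ : SimpleGraph (Fin n)).edgeSet := by
    rw [prod_const, card_univ, Fintype.card_bool]; norm_num
  rw [hprod, hcsum] at hH
  have hexp : Real.exp (-((κ / 12 : ℝ) ^ 2 / (2 * (κ / 4)))) = Real.exp (-(κ / 72 : ℝ)) := by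
    congr 1
    field_simp
    ring
  rw [hexp] at hH
  refine le_trans ?_ hH
  -- the bad event is contained in the Hoeffding tail
  have hsub : badDegAt S T u ⊆ univ.filter fun x : EdgeVec n => (κ : ℝ) / 12 ≤ ∑ e, f e (x e) := by
    intro x hx
    rw [mem_badDegAt] at hx
    rw [mem_filter, hstat x]
    refine ⟨mem_univ _, ?_⟩
    have hx' : (7 * κ : ℝ) / 12 ≤
        ((T.filter fun w => (graphOfEdgeVec (plant S x)).Adj u w).card : ℝ) := by
      convert hx using 2
    linarith
  exact_mod_cast card_le_card hsub

/-- **The bad degree event is small**: for `T ⊆ S` nonempty,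
`#badDeg ≤ n · e^{-|T|/72} · 2^{#E}`. [cite: AlonKrivelevichSudakov1998, §2.2 (last paragraph)] -/
theorem card_badDeg_le {S T : Finset (Fin n)} (hTS : T ⊆ S) (hT : 1 ≤ T.card) :
    ((badDeg S T).card : ℝ) ≤
      n * (Real.exp (-(T.card / 72 : ℝ)) * 2 ^ Fintype.card (⊤ : SimpleGraph (Fin n)).edgeSet) := by
  classical
  calc ((badDeg S T).card : ℝ) ≤ ∑ u ∈ univ \ S, ((badDegAt S T u).card : ℝ) := by
        rw [badDeg]; exact_mod_cast card_biUnion_le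
    _ ≤ ∑ _u ∈ univ \ S, Real.exp (-(T.card / 72 : ℝ)) *
          2 ^ Fintype.card (⊤ : SimpleGraph (Fin n)).edgeSet :=
        sum_le_sum fun u hu => card_badDegAt_le hTS hT (mem_sdiff.1 hu).2
    _ = (univ \ S).card * (Real.exp (-(T.card / 72 : ℝ)) *
          2 ^ Fintype.card (⊤ : SimpleGraph (Fin n)).edgeSet) := by
        rw [sum_const, nsmul_eq_mul]
    _ ≤ n * (Real.exp (-(T.card / 72 : ℝ)) * 2 ^ Fintype.card (⊤ : SimpleGraph (Fin n)).edgeSet) := by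
        gcongr
        have : ((univ \ S).card : ℝ) ≤ (univ : Finset (Fin n)).card := by
          exact_mod_cast card_le_card sdiff_subset
        simpa using this

/-! ### The size of the common neighbourhood of the seed -/

/-- The number of vertices outside `S` adjacent to every vertex of the seed `S'`.
[cite: AlonKrivelevichSudakov1998, §2.3 (`|N*(S)|`)] -/
def outsideNbrCount (S S' : Finset (Fin n)) (x : EdgeVec n) : ℕ :=
  open scoped Classical in
  ((univ \ S).filter fun v => ∀ w ∈ S', (graphOfEdgeVec (plant S x)).Adj v w).card

/-- The bad size event: at least `2n/2ˢ` vertices outside `S` are adjacent to all of the seed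
`S'`, `s = |S'|`. [cite: AlonKrivelevichSudakov1998, §2.3 (`|N*(S)| = (1+o(1))n/2ˢ`)] -/
def badSize (S S' : Finset (Fin n)) : Finset (EdgeVec n) :=
  univ.filter fun x => (2 * n : ℝ) / 2 ^ S'.card ≤ outsideNbrCount S S' x

/-- Membership in the bad size event. [folklore] -/
theorem mem_badSize {S S' : Finset (Fin n)} {x : EdgeVec n} :
    x ∈ badSize S S' ↔ (2 * n : ℝ) / 2 ^ S'.card ≤ outsideNbrCount S S' x := by
  simp [badSize]

/-- The edges from a vertex `v ∉ S` to the seed. [folklore] -/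
def seedEdges (S S' : Finset (Fin n)) (hS'S : S' ⊆ S) (v : Fin n) (hv : v ∉ S) :
    Finset (⊤ : SimpleGraph (Fin n)).edgeSet :=
  S'.attach.image fun w : {w // w ∈ S'} => crossEdge S v hv ⟨w.val, hS'S w.property⟩

/-- There are `|S'|` edges from `v` to the seed. [folklore] -/
theorem card_seedEdges {S S' : Finset (Fin n)} (hS'S : S' ⊆ S) {v : Fin n} (hv : v ∉ S) :
    (seedEdges S S' hS'S v hv).card = S'.card := by
  rw [seedEdges, card_image_of_injOn, card_attach]
  intro w _ w' _ h
  exact Subtype.ext (Subtype.mk.inj (crossEdge_injective S v hv h))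

/-- Being adjacent to all of the seed is the cylinder event of the seed edges. [folklore] -/
theorem forall_adj_iff_forall_seedEdges {S S' : Finset (Fin n)} (hS'S : S' ⊆ S) {v : Fin n}
    (hv : v ∉ S) (x : EdgeVec n) :
    (∀ w ∈ S', (graphOfEdgeVec (plant S x)).Adj v w) ↔
      ∀ e ∈ seedEdges S S' hS'S v hv, x e = true := by
  constructor
  · intro h e he
    rw [seedEdges, mem_image] at he
    obtain ⟨w, -, rfl⟩ := he
    have hvw : v ≠ w := fun h' => hv (h' ▸ hS'S w.2)
    exact (adj_plant_iff_of_not_mem x hv hvw).1 (h w w.2)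
  · intro h w hw
    have hvw : v ≠ w := fun h' => hv (h' ▸ hS'S hw)
    rw [adj_plant_iff_of_not_mem x hv hvw]
    exact h _ (mem_image.2 ⟨⟨w, hw⟩, mem_attach _ _, rfl⟩)

/-- Seed edge sets of distinct outside vertices are disjoint. [folklore] -/
theorem disjoint_seedEdges {S S' : Finset (Fin n)} (hS'S : S' ⊆ S) {v v' : Fin n} (hv : v ∉ S)
    (hv' : v' ∉ S) (hvv' : v ≠ v') : Disjoint (seedEdges S S' hS'S v hv) (seedEdges S S' hS'S v' hv') := by
  rw [Finset.disjoint_left]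
  intro e he he'
  rw [seedEdges, mem_image] at he he'
  obtain ⟨w, -, rfl⟩ := he
  obtain ⟨w', -, h⟩ := he'
  have h' : (s(v', (w' : Fin n)) : Sym2 (Fin n)) = s(v, (w : Fin n)) := congrArg Subtype.val h
  rw [Sym2.eq_iff] at h'
  rcases h' with ⟨h1, -⟩ | ⟨h1, -⟩
  · exact hvv' h1.symm
  · exact hv' (h1 ▸ hS'S w.2)

/-- The indicator of "adjacent to all of the seed" depends only on the seed edges. [folklore] -/
theorem indicator_dependsOn {S S' : Finset (Fin n)} (hS'S : S' ⊆ S) {v : Fin n} (hv : v ∉ S)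
    (x x' : EdgeVec n) (h : ∀ e ∈ seedEdges S S' hS'S v hv, x e = x' e) :
    (open scoped Classical in
      (if ∀ w ∈ S', (graphOfEdgeVec (plant S x)).Adj v w then (1 : ℝ) else 0)) =
      (open scoped Classical in
      (if ∀ w ∈ S', (graphOfEdgeVec (plant S x')).Adj v w then (1 : ℝ) else 0)) := by
  classical
  have : (∀ w ∈ S', (graphOfEdgeVec (plant S x)).Adj v w) ↔
      ∀ w ∈ S', (graphOfEdgeVec (plant S x')).Adj v w := by
    rw [forall_adj_iff_forall_seedEdges hS'S hv x, forall_adj_iff_forall_seedEdges hS'S hv x']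
    exact ⟨fun h1 e he => (h e he) ▸ h1 e he, fun h1 e he => (h e he).symm ▸ h1 e he⟩
  simp only [this]

/-- The indicator has mean `2^{-s}`: `Σₓ 1[v ~ S'] = 2^{#E} / 2ˢ`. [folklore] -/
theorem sum_indicator_eq {S S' : Finset (Fin n)} (hS'S : S' ⊆ S) {v : Fin n} (hv : v ∉ S) :
    (open scoped Classical in
      ∑ x : EdgeVec n, (if ∀ w ∈ S', (graphOfEdgeVec (plant S x)).Adj v w then (1 : ℝ) else 0)) =
      2 ^ Fintype.card (⊤ : SimpleGraph (Fin n)).edgeSet / 2 ^ S'.card := by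
  classical
  rw [sum_boole]
  have hset : (univ.filter fun x : EdgeVec n => ∀ w ∈ S', (graphOfEdgeVec (plant S x)).Adj v w) =
      univ.filter fun x : EdgeVec n => ∀ e ∈ seedEdges S S' hS'S v hv, x e = true := by
    ext x
    simp only [mem_filter, mem_univ, true_and]
    exact forall_adj_iff_forall_seedEdges hS'S hv x
  rw [hset, ← card_seedEdges hS'S hv]
  convert card_filter_forall_eq_true_eq_div (seedEdges S S' hS'S v hv) using 2

/-- Centred indicators of distinct outside vertices are orthogonal (product rule).
[cite: AlonKrivelevichSudakov1998, §2.3 ("binomially distributed", i.e. independent indicators)] -/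
theorem sum_centred_mul_centred_eq_zero {S S' : Finset (Fin n)} (hS'S : S' ⊆ S) {v v' : Fin n}
    (hv : v ∉ S) (hv' : v' ∉ S) (hvv' : v ≠ v') (p : ℝ)
    (hp : p = 1 / 2 ^ S'.card) :
    (open scoped Classical in
      ∑ x : EdgeVec n,
        ((if ∀ w ∈ S', (graphOfEdgeVec (plant S x)).Adj v w then (1 : ℝ) else 0) - p) *
        ((if ∀ w ∈ S', (graphOfEdgeVec (plant S x)).Adj v' w then (1 : ℝ) else 0) - p)) = 0 := by
  classical
  have hE : (2 : ℝ) ^ Fintype.card (⊤ : SimpleGraph (Fin n)).edgeSet ≠ 0 := pow_ne_zero _ two_ne_zero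
  have hprod := sum_mul_sum_eq_of_disjoint (disjoint_seedEdges hS'S hv hv' hvv')
    (fun x => (if ∀ w ∈ S', (graphOfEdgeVec (plant S x)).Adj v w then (1 : ℝ) else 0) - p)
    (fun x => (if ∀ w ∈ S', (graphOfEdgeVec (plant S x)).Adj v' w then (1 : ℝ) else 0) - p)
    (fun x x' h => by rw [indicator_dependsOn hS'S hv x x' h])
    (fun x x' h => by rw [indicator_dependsOn hS'S hv' x x' h])
  have hmean : ∑ x : EdgeVec n,
      ((if ∀ w ∈ S', (graphOfEdgeVec (plant S x)).Adj v w then (1 : ℝ) else 0) - p) = 0 := by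
    rw [sum_sub_distrib, sum_indicator_eq hS'S hv, sum_const, card_univ, nsmul_eq_mul, hp,
      Fintype.card_fun, Fintype.card_bool]
    push_cast
    ring
  rw [hmean, zero_mul] at hprod
  exact (mul_eq_zero.1 hprod).resolve_right hE

/-- The centred indicator has second moment `p(1-p) 2^{#E} ≤ p 2^{#E}`. [folklore] -/
theorem sum_centred_sq_le {S S' : Finset (Fin n)} (hS'S : S' ⊆ S) {v : Fin n} (hv : v ∉ S)
    (p : ℝ) (hp : p = 1 / 2 ^ S'.card) :
    (open scoped Classical in
      ∑ x : EdgeVec n,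
        ((if ∀ w ∈ S', (graphOfEdgeVec (plant S x)).Adj v w then (1 : ℝ) else 0) - p) *
        ((if ∀ w ∈ S', (graphOfEdgeVec (plant S x)).Adj v w then (1 : ℝ) else 0) - p)) ≤
      p * 2 ^ Fintype.card (⊤ : SimpleGraph (Fin n)).edgeSet := by
  classical
  have hp0 : 0 ≤ p := by rw [hp]; positivity
  have hp1 : p ≤ 1 := by
    rw [hp, div_le_one (by positivity)]
    exact one_le_pow₀ (by norm_num)
  -- `(I - p)² = I (1 - 2p) + p²` for an indicator `I`
  have hsq : ∀ x : EdgeVec n,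
      ((if ∀ w ∈ S', (graphOfEdgeVec (plant S x)).Adj v w then (1 : ℝ) else 0) - p) *
        ((if ∀ w ∈ S', (graphOfEdgeVec (plant S x)).Adj v w then (1 : ℝ) else 0) - p) =
        (if ∀ w ∈ S', (graphOfEdgeVec (plant S x)).Adj v w then (1 : ℝ) else 0) * (1 - 2 * p) +
          p ^ 2 := by
    intro x
    split_ifs <;> ring
  simp_rw [hsq]
  rw [sum_add_distrib, ← sum_mul, sum_indicator_eq hS'S hv, sum_const, card_univ, nsmul_eq_mul,
    Fintype.card_fun, Fintype.card_bool]
  push_cast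
  have h2E : (0 : ℝ) < 2 ^ Fintype.card (⊤ : SimpleGraph (Fin n)).edgeSet := by positivity
  have : (2 : ℝ) ^ Fintype.card (⊤ : SimpleGraph (Fin n)).edgeSet / 2 ^ S'.card =
      p * 2 ^ Fintype.card (⊤ : SimpleGraph (Fin n)).edgeSet := by rw [hp]; ring
  rw [this]
  nlinarith [mul_nonneg (mul_nonneg hp0 hp0) h2E.le, hp1]

/-- **The bad size event is small** (Chebyshev): for `S' ⊆ S` and `n ≥ 1`,
`#badSize ≤ (2ˢ/n) · 2^{#E}`. [cite: AlonKrivelevichSudakov1998, §2.3 (`|N*(S)| = (1+o(1)) n/2ˢ` almost surely)] -/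
theorem card_badSize_le {S S' : Finset (Fin n)} (hS'S : S' ⊆ S) (hn : 1 ≤ n) :
    ((badSize S S').card : ℝ) ≤
      2 ^ S'.card / n * 2 ^ Fintype.card (⊤ : SimpleGraph (Fin n)).edgeSet := by
  classical
  set E2 : ℝ := 2 ^ Fintype.card (⊤ : SimpleGraph (Fin n)).edgeSet with hE2
  set p : ℝ := 1 / 2 ^ S'.card with hp
  have hp0 : 0 < p := by rw [hp]; positivity
  have hn0 : (0 : ℝ) < n := by exact_mod_cast hn
  -- the indicators, the statistic and its mean
  set I : Fin n → EdgeVec n → ℝ := fun v x =>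
    if ∀ w ∈ S', (graphOfEdgeVec (plant S x)).Adj v w then (1 : ℝ) else 0 with hI
  set V := (univ : Finset (Fin n)) \ S with hV
  have hVn : (V.card : ℝ) ≤ n := by
    have : V.card ≤ (univ : Finset (Fin n)).card := card_le_card sdiff_subset
    simpa using (show (V.card : ℝ) ≤ (univ : Finset (Fin n)).card by exact_mod_cast this)
  have hX : ∀ x, (outsideNbrCount S S' x : ℝ) = ∑ v ∈ V, I v x := by
    intro x
    rw [outsideNbrCount, hI, sum_boole]
  set μ : ℝ := V.card * p with hμ
  -- second moment of `X - μ`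
  have hvar : ∑ x : EdgeVec n, (∑ v ∈ V, I v x - μ) ^ 2 ≤ n * p * E2 := by
    have hrw : ∀ x : EdgeVec n, ∑ v ∈ V, I v x - μ = ∑ v ∈ V, (I v x - p) := by
      intro x; rw [sum_sub_distrib, sum_const, nsmul_eq_mul]
    simp_rw [hrw, sq, sum_mul_sum]
    rw [sum_comm]
    calc ∑ v ∈ V, ∑ x : EdgeVec n, ∑ v' ∈ V, (I v x - p) * (I v' x - p)
        = ∑ v ∈ V, ∑ v' ∈ V, ∑ x : EdgeVec n, (I v x - p) * (I v' x - p) := by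
          refine sum_congr rfl fun v _ => ?_; rw [sum_comm]
      _ = ∑ v ∈ V, ∑ x : EdgeVec n, (I v x - p) * (I v x - p) := by
          refine sum_congr rfl fun v hv => ?_
          rw [sum_eq_single v]
          · intro v' hv' hne
            exact sum_centred_mul_centred_eq_zero hS'S (mem_sdiff.1 hv).2 (mem_sdiff.1 hv').2
              (Ne.symm hne) p hp
          · intro h; exact absurd hv h
      _ ≤ ∑ _v ∈ V, p * E2 := sum_le_sum fun v hv => sum_centred_sq_le hS'S (mem_sdiff.1 hv).2 p hp
      _ = V.card * (p * E2) := by rw [sum_const, nsmul_eq_mul]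
      _ ≤ n * (p * E2) := by gcongr
      _ = n * p * E2 := by ring
  -- Chebyshev
  have hsub : ∀ x ∈ badSize S S', (n * p) ^ 2 ≤ (∑ v ∈ V, I v x - μ) ^ 2 := by
    intro x hx
    rw [mem_badSize, hX x] at hx
    have hdev : n * p ≤ ∑ v ∈ V, I v x - μ := by
      rw [hμ]
      have : (2 * n : ℝ) / 2 ^ S'.card = 2 * (n * p) := by rw [hp]; ring
      rw [this] at hx
      nlinarith [mul_le_mul_of_nonneg_right hVn hp0.le]
    exact pow_le_pow_left₀ (by positivity) hdev 2
  have hcheb : ((badSize S S').card : ℝ) * (n * p) ^ 2 ≤ n * p * E2 := by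
    calc ((badSize S S').card : ℝ) * (n * p) ^ 2 = ∑ x ∈ badSize S S', (n * p) ^ 2 := by
          rw [sum_const, nsmul_eq_mul]
      _ ≤ ∑ x ∈ badSize S S', (∑ v ∈ V, I v x - μ) ^ 2 := sum_le_sum hsub
      _ ≤ ∑ x : EdgeVec n, (∑ v ∈ V, I v x - μ) ^ 2 :=
          sum_le_sum_of_subset_of_nonneg (subset_univ _) fun x _ _ => sq_nonneg _
      _ ≤ n * p * E2 := hvar
  have hnp : 0 < n * p := mul_pos hn0 hp0
  rw [← le_div_iff₀ (pow_pos hnp 2)] at hcheb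
  refine hcheb.trans (le_of_eq ?_)
  rw [hp]
  field_simp


end Literature.Probability.RandomGraphs.PlantedClique

end
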